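import Mathlib.CategoryTheory.Galois.Basic
import Mathlib.CategoryTheory.Comma.Over.Pullback
import Mathlib.CategoryTheory.Limits.FintypeCat
import Literature.AnabelianGeometry.Anabelioids.FiniteEtaleFiberFunctor
import HarnessLib

/-!
# Anabelioids: `(S × −) : C → C_{/S}` reflects isomorphisms for connected `S`

Mochizuki, *The geometry of anabelioids*, Publ. RIMS **40** (2004), §1.2 Def. 1.2.2 (i) p. 17: a
finite étale morphism has pull-back functor `φ^* ≅ i_S^* ∘ α^*`, `i_S^* = (S × −)`
[cite: MochizukiGeoAn2004, Def. 1.2.2(i) p.17].  For the induced basepoint `φ^* ⋙ F` to be a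
basepoint (fibre functor) one needs, besides exactness of `i_S^*`, that `i_S^*` REFLECTS
isomorphisms; this holds as soon as `S` is not initial (e.g. connected): on fibres `S × f` is
`F₀(S) × F₀(f)` with `F₀(S) ≠ ∅`.

PROOF-ONLY (abc-iut L3 row `L3:FiniteEtaleLocalDictionary`, glue (d0), L6-t17):

* `FintypeCat.isIso_of_isIso_prod_map_id` — in `FintypeCat`, if `A` is nonempty and `A × g` is an
  isomorphism then `g` is (points `1 ⟶ A × B` and the universal property of the product);
* `reflectsIsomorphisms_overStar` — `(Over.star S).ReflectsIsomorphisms` for connected `S` in a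
  Galois category (transport through a fibre functor `F₀` and the product comparison);
* `nonempty_fiberFunctor_of_iso_star_comp'`, `nonempty_iso_fiberFunctor_of_iso_star_comp'` — the
  glue of `FiniteEtaleFiberFunctor.lean` with that hypothesis discharged for connected `S`.
-/

namespace Literature.AnabelianGeometry.Anabelioids

open CategoryTheory CategoryTheory.Limits CategoryTheory.Functor CategoryTheory.PreGaloisCategory

universe w u₁ u₂ u₃

section Fintype

/-- In `FintypeCat`: if `A` is nonempty and `A × g : A × B → A × B'` is an isomorphism, then `g` is an
isomorphism (test against points `1 ⟶ A × B`). [cite: MochizukiGeoAn2004, Def. 1.2.2(i) p.17] -/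
theorem FintypeCat.isIso_of_isIso_prod_map_id {A B B' : FintypeCat.{w}} [Nonempty A] (g : B ⟶ B')
    [IsIso (prod.map (𝟙 A) g)] : IsIso g := by
  obtain ⟨a⟩ := (inferInstance : Nonempty A)
  let pa : FintypeCat.of PUnit.{w + 1} ⟶ A := FintypeCat.homMk fun _ => a
  let pt : ∀ {Z : FintypeCat.{w}} (_ : Z), (FintypeCat.of PUnit.{w + 1} ⟶ Z) :=
    fun {Z} z => FintypeCat.homMk fun _ => z
  refine (ConcreteCategory.isIso_iff_bijective g).mpr ⟨fun b₁ b₂ h => ?_, fun b' => ?_⟩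
  · -- injectivity: the points `(a, b₁)`, `(a, b₂)` of `A × B` have the same image under `A × g`
    have hpt : ∀ b : B, pt b ≫ g = pt (g b) := by
      intro b
      ext ⟨⟩
      rfl
    have hcomp : ∀ b : B, prod.lift pa (pt b) ≫ prod.map (𝟙 A) g = prod.lift pa (pt (g b)) := by
      intro b
      rw [prod.lift_map, Category.comp_id, hpt]
    have heq : prod.lift pa (pt b₁) ≫ prod.map (𝟙 A) g = prod.lift pa (pt b₂) ≫ prod.map (𝟙 A) g := by
      rw [hcomp, hcomp, h]
    have h2 := (cancel_mono (prod.map (𝟙 A) g)).mp heq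
    have e1 : prod.lift pa (pt b₁) ≫ prod.snd = pt b₁ := prod.lift_snd _ _
    have e2 : prod.lift pa (pt b₂) ≫ prod.snd = pt b₂ := prod.lift_snd _ _
    rw [h2] at e1
    have h3 : pt b₁ = pt b₂ := e1.symm.trans e2
    exact congrArg (fun f : FintypeCat.of PUnit.{w + 1} ⟶ B => f PUnit.unit) h3
  · -- surjectivity: pull the point `(a, b')` back along the isomorphism `A × g`
    let q : FintypeCat.of PUnit.{w + 1} ⟶ A ⨯ B := prod.lift pa (pt b') ≫ inv (prod.map (𝟙 A) g)
    refine ⟨(q ≫ prod.snd) PUnit.unit, ?_⟩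
    have e3 : prod.snd ≫ g = prod.map (𝟙 A) g ≫ prod.snd := (prod.map_snd (𝟙 A) g).symm
    have hq : q ≫ prod.snd ≫ g = pt b' := by
      rw [e3]
      show (prod.lift pa (pt b') ≫ inv (prod.map (𝟙 A) g)) ≫ prod.map (𝟙 A) g ≫ prod.snd = pt b'
      rw [Category.assoc, IsIso.inv_hom_id_assoc]
      exact prod.lift_snd _ _
    exact congrArg (fun f : FintypeCat.of PUnit.{w + 1} ⟶ B' => f PUnit.unit) hq

end Fintype

section Star

variable {C : Type u₁} [Category.{u₂} C] [GaloisCategory C]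

/-- **`(S × −) : C → C_{/S}` reflects isomorphisms** when `S` is connected (indeed whenever its fibre
is nonempty): through a fibre functor `F₀`, `S × f` becomes `F₀(S) × F₀(f)` (product comparison),
and `F₀(S) ≠ ∅`. [cite: MochizukiGeoAn2004, Def. 1.2.2(i) p.17] -/
theorem reflectsIsomorphisms_overStar (S : C) [IsConnected S] : (Over.star S).ReflectsIsomorphisms := by
  refine ⟨fun {X Y} f hf => ?_⟩
  let F₀ := GaloisCategory.getFiberFunctor C
  -- `S × f` is an isomorphism in `C`, hence `F₀(S × f)` one in `FintypeCat`
  have h1 : IsIso (F₀.map ((Over.forget S).map ((Over.star S).map f))) := inferInstance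
  simp only [Over.forget_map, Over.star_map_left] at h1
  haveI : IsIso (F₀.map (prod.map (𝟙 S) f)) := h1
  have hnat := prodComparison_natural F₀ (𝟙 S) f
  have h3 : IsIso (prodComparison F₀ S X ≫ prod.map (F₀.map (𝟙 S)) (F₀.map f)) := by
    rw [← hnat]
    infer_instance
  have h4 : IsIso (prod.map (F₀.map (𝟙 S)) (F₀.map f)) :=
    IsIso.of_isIso_comp_left (prodComparison F₀ S X) _
  rw [F₀.map_id] at h4
  haveI : IsIso (F₀.map f) := FintypeCat.isIso_of_isIso_prod_map_id (A := F₀.obj S) (F₀.map f)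
  exact isIso_of_reflects_iso f F₀

variable {D : Type u₃} [Category.{u₂} D] [GaloisCategory D]

/-- `Q ⋙ F` is a basepoint of `C` for a finite étale pull-back `Q ≅ (S × −) ⋙ α` with `S`
CONNECTED, given the colimit-exactness of `Over.star S` (finite coproducts, epis, quotients by
finite groups). [cite: MochizukiGeoAn2004, Def. 1.2.2(i) p.17] -/
theorem nonempty_fiberFunctor_of_iso_star_comp' (S : C) [IsConnected S] (α : Over S ⥤ D)
    [α.IsEquivalence] {Q : C ⥤ D} (e : Q ≅ Over.star S ⋙ α) (F : D ⥤ FintypeCat.{u₂})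
    [FiberFunctor F] [PreservesFiniteCoproducts (Over.star S)] [(Over.star S).PreservesEpimorphisms]
    [hq : ∀ (G : Type u₂) [Group G] [Finite G], PreservesColimitsOfShape (SingleObj G) (Over.star S)] :
    Nonempty (FiberFunctor (Q ⋙ F)) := by
  haveI := reflectsIsomorphisms_overStar S
  exact nonempty_fiberFunctor_of_iso_star_comp S α e F (hq := hq)

/-- The comparison `Q ⋙ F ≅ G` with any basepoint `G` of `C`, for connected `S`, given the
colimit-exactness of `Over.star S`. [cite: MochizukiGeoAn2004, Def. 1.1.2(ii) p.10] -/
theorem nonempty_iso_fiberFunctor_of_iso_star_comp' (S : C) [IsConnected S] (α : Over S ⥤ D)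
    [α.IsEquivalence] {Q : C ⥤ D} (e : Q ≅ Over.star S ⋙ α) (F : D ⥤ FintypeCat.{u₂})
    [FiberFunctor F] (G : C ⥤ FintypeCat.{u₂}) [FiberFunctor G]
    [PreservesFiniteCoproducts (Over.star S)] [(Over.star S).PreservesEpimorphisms]
    [hq : ∀ (G : Type u₂) [Group G] [Finite G], PreservesColimitsOfShape (SingleObj G) (Over.star S)] :
    Nonempty (Q ⋙ F ≅ G) := by
  haveI := reflectsIsomorphisms_overStar S
  exact nonempty_iso_fiberFunctor_of_iso_star_comp S α e F G (hq := hq)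

end Star

end Literature.AnabelianGeometry.Anabelioids
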